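/-
Copyright: statement-level skeleton of a published paper (lit-balaban cell, Phase-2 proof seat p25, gen 15; v1.1 header
quotation repair gen 16, declarations byte-identical). No proof claims beyond what the kernel checks below.
-/
import Literature.MathematicalPhysics.QuantumFieldTheory.BalabanImbrieJaffe1984to88.BIJ88VertexComponentsExpansion311
import Literature.MathematicalPhysics.QuantumFieldTheory.BalabanImbrieJaffe1984to88.BIJ88IbpLeibniz312
import Literature.MathematicalPhysics.QuantumFieldTheory.BalabanImbrieJaffe1984to88.BIJ88VertexChiShell312
import Literature.MathematicalPhysics.QuantumFieldTheory.BalabanImbrieJaffe1984to88.BIJ88SlotMomentsGauss308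

/-!
# `BalabanImbrieJaffe1984to88.BIJ88VertexComponentsFieldLaw312` — T. Bałaban, J. Imbrie, A. Jaffe, *Effective action and
cluster properties of the abelian Higgs model*, Commun. Math. Phys. **114** (1988) 257–315 [BalabanImbrieJaffe1988],
§5.14 p. 311–312 [PDF 55–56] *"Then the result of the integration by parts is ⟨Π_{σ_i}F^{m̄}_{k,loc}(X_{σ_i})⟩ =
Σ Π_c F^L_{k+1,loc}(X_c) ⟨Π_r F_{k,rem}(X_r)⟩"* (display), *"Having extracted the desired perturbative terms
F_{k+1,loc}(X_c), we need to finish the calculation of the remainders by giving a cluster expansion for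
⟨Π_r F_{k,rem}(X_r)⟩_1 with appropriate bounds."*, *"By performing sufficiently many integrations by parts, we have
arranged for enough small factors to beat these large factors in the remainder terms"* (v1.1, ref-5 DF-g50-1: three
separately printed p. 312 passages, text layer p0056 L5–8, L10–12, L23–25; the v1.0 header spliced in at this place a
clause *Convergence … remainder components* that is NOT in print — withdrawn, it was this file's paraphrase) — **THE COMPONENT EXPANSION ON THE MODEL OF RECORD, ITS CUTOFF HYPOTHESES
DISCHARGED, AND THE SMALL FACTORS COUNTED PER COMPONENT**: the capstone of p25 gen 15's per-component files
`BIJ88VertexComponents311` (print's stopping rule) and `BIJ88VertexComponentsExpansion311` (the identity, the coefficient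
bound).  (1) For a smooth compactly supported cutoff `χ` the two analytic hypotheses of `cexpansion` hold for every list
of `χ′`-directions (`hasCompactSupport_dlist`, `dlist_contDiff_one`, `dlist_vexp_bounded`), so the expansion holds
outright (`cexpansion_init_cs`) and on p36's law of the fields `fieldLaw blk Δ ℱ W` (`cexpansion_fieldLaw`, display
`cexpansion_display_fieldLaw`).  (2) Every term's components are constant or remainder and the term carries `≥ M = m̄+1`
coupling constants per vertex-saturated component and `≥ 1` derivative of the cutoff per `χ′`-component
(`small_factor_count`, `ccoef_bound_init`: `|coef| ≤ (max B 1)^{pot₀}·c_M^{M·#sat}`); a term with a `χ′` is bounded by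
Cauchy–Schwarz through the Gaussian mass of the shell where `χ` is not locally constant (`dlist_eq_zero_off_shell`,
`abs_gint_le_shell`).

statement-level skeleton of published theorems with citation tags; proofs where landed; nothing here is a claim
about the Yang–Mills mass gap

PDF held: `paper:balaban1988-cmp114-bij-abelian-higgs-effective-action` (journal page = PDF page + 256); p. 311–312 =
PDF 55–56.

CITATION HEADER (lean-in-tree rule).  lit-balaban cell (HOME `run/shared/lean/pub/lit-balaban/`), Phase 2, seat p25
gen 15; row **C2.Claim@312** of `HOME/lit-balaban-r16/ROWS-C2-part2.md` (owner r16, referee ref-5; head untouched —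
flip-path items (β) for all components and the counting half of (γ) "each remainder component carries a small
factor").  USED BY NAME, nothing restated: `BIJ88VertexComponents311`/`BIJ88VertexComponentsExpansion311` (this seat and
generation), `BIJ88VertexChiShell312.abs_integral_mul_le_shell` (this seat), `BIJ88VertexIbp311`, p25 gen 14's
`BIJ88WickDerivatives305.{dlist, contDiff_fderiv_apply_const}` and `BIJ88IbpLeibniz312.dlist_contDiff`, p36 gen 8's
`BIJ88SlotMomentsGauss308.{fieldLaw, integral_fieldLaw}`, `B2Eq228Conditioning.{weight, source}`.

## What is proved (0 `sorry`, standard axioms, no new `Prop` facts, no new definitions)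

* §1 `hasCompactSupport_dlist`, `dlist_contDiff_one`, `dlist_vexp_bounded`, **`cexpansion_init_cs`**;
* §2 `dlist_eq_zero_of_eqOn`, **`dlist_eq_zero_off_shell`** (`∂χ = 0` off a closed `Sh` ⇒ `(Π_D∂)χ = 0` off `Sh`,
  `D ≠ []`), **`abs_gint_le_shell`** (`|∫Π_PΦ·(Π_D∂)χ·e^{−V}dμ| ≤ √(∫Π_{P++P}Φ dμ)·K_D·√μ(Sh)`);
* §3 `mul_countP_le_sum_nv`, `countP_le_sum_nchi`, **`small_factor_count`**, `pot_init`, **`ccoef_bound_init`**,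
  **`remainder_term_dichotomy`** (a term with a remainder component has a `χ′` under the integral or `≥ M` couplings);
* §4 **`cexpansion_fieldLaw`**, **`cexpansion_display_fieldLaw`** (normalized: a fully contracted term without `χ′`
  contributes its bare coefficient, every other term its coefficient times a normalized remainder expectation).
HONEST SCOPE.  (a) As in the siblings: components = contraction-graph components, one covariance (no random-walk
trigger, no `C_loc` split), fixed order of integrations by parts, no resummation of the constant components into
`Π_c F^L(X_c)` with `{X_c}` determined by the remainder components.  (b) ONE shell factor `√μ(Sh)` per term however
many `χ′`-components it has (print gets one per component from locality), and the vertex factor is the bare count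
`c_M^{M·#sat}` — the sizes of `K_D`, of the moments `∫Π_{P++P}Φdμ`, of `μ(Sh)` (p36's shell tails) and of the
combinatorial factor `(max B 1)^{pot₀}` are NOT estimated: the printed *"appropriate bounds"* for the remainder
components (p. 312) stay the row's open head question.  NOT summit progress; NOT continuum; NOT Clay.  Imports the four files named above; modifies nothing.
-/

noncomputable section

namespace Literature.MathematicalPhysics.QuantumFieldTheory.BalabanImbrieJaffe1984to88.BIJ88VertexComponentsFieldLaw312

open MeasureTheory Matrix Finset
open scoped BigOperators ContDiff
open Literature.MathematicalPhysics.QuantumFieldTheory.Balaban1983to89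
open B2Eq228Conditioning (weight source)
open BIJ88PolymerRep5134 (corner)
open BIJ88PolymerRep5134Gauss (prec src)
open BIJ88SlotMomentsGauss308 (fieldLaw integral_fieldLaw integral_density_pos)
open BIJ88VertexIbp311 (lmono vexp lmono_nil lmono_append continuous_lmono continuous_vexp integrable_lmono)
open BIJ88WickDerivatives305 (dlist dlist_nil dlist_cons contDiff_fderiv_apply_const)
open BIJ88IbpLeibniz312 (dlist_contDiff)
open BIJ88VertexChiShell312 (abs_integral_mul_le_shell)
open BIJ88VertexComponents311
open BIJ88VertexComponentsExpansion311 (gint cexpansion_init ccoef_bound)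

variable {S : Type} [Fintype S] {ι : Type} [Fintype ι]

/-! ## §1  The cutoff hypotheses of `cexpansion` from smoothness and compact support -/

/-- Iterated directional derivatives of a compactly supported smooth cutoff are compactly supported.
[folklore] [cite: BalabanImbrieJaffe1988, §5.14 p.311] -/
theorem hasCompactSupport_dlist : ∀ (D : List (S → ℝ)) {χ : (S → ℝ) → ℝ}, ContDiff ℝ ∞ χ →
    HasCompactSupport χ → HasCompactSupport (dlist D χ)
  | [], _, _, hs => hs
  | u :: D, _, hχ, hs => by
    rw [dlist_cons]
    exact hasCompactSupport_dlist D (contDiff_fderiv_apply_const hχ u) (hs.fderiv_apply (𝕜 := ℝ) u)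

/-- Iterated directional derivatives of a smooth cutoff are `C¹` (the regularity `cexpansion` asks of `(Π_D∂)χ`).
[folklore] [cite: BalabanImbrieJaffe1988, §5.14 p.311] -/
theorem dlist_contDiff_one (D : List (S → ℝ)) {χ : (S → ℝ) → ℝ} (hχ : ContDiff ℝ ∞ χ) : ContDiff ℝ 1 (dlist D χ) :=
  (dlist_contDiff D hχ).of_le (by exact_mod_cast le_top)

/-- `((Π_D∂)χ)·e^{−V}` is bounded when `χ` is smooth with compact support (the boundedness `cexpansion` asks for).
[folklore] [cite: BalabanImbrieJaffe1988, §5.14 p.311] -/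
theorem dlist_vexp_bounded (c : ι → ℝ) (legs : ι → List (S → ℝ)) {χ : (S → ℝ) → ℝ} (hχ : ContDiff ℝ ∞ χ)
    (hs : HasCompactSupport χ) (D : List (S → ℝ)) : ∃ K, ∀ φ, ‖dlist D χ φ * vexp c legs φ‖ ≤ K := by
  have hc : Continuous fun φ => dlist D χ φ * vexp c legs φ :=
    (dlist_contDiff D hχ).continuous.mul (continuous_vexp c legs)
  exact hc.bounded_above_of_compact_support ((hasCompactSupport_dlist D hχ hs).mul_right (f' := vexp c legs))

variable [DecidableEq S]

/-- **THE COMPONENT EXPANSION OF A PRODUCT OF OBSERVABLES FOR A SMOOTH COMPACTLY SUPPORTED CUTOFF** (`cexpansion_init`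
with its two cutoff hypotheses discharged): `∫ Π_{all legs}Φ · χe^{−V} dμ = Σ_t coef_t ∫ Π_{pending legs of t}Φ ·
(Π_{dirs t}∂)χ · e^{−V} dμ`, the sum over the terms of print's stopping-rule expansion `cterms`.
[cite: BalabanImbrieJaffe1988, §5.14 p.311–312] -/
theorem cexpansion_init_cs {A : Matrix S S ℝ} (hA : A.PosDef) (f : S → ℝ) (c : ι → ℝ) (legs : ι → List (S → ℝ))
    {χ : (S → ℝ) → ℝ} (hχ : ContDiff ℝ ∞ χ) (hs : HasCompactSupport χ) (M : ℕ) (obs : List (List (S → ℝ))) :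
    ∫ φ : S → ℝ, lmono obs.flatten φ * (χ φ * vexp c legs φ) * (weight A φ * source f φ)
      = ((cterms A f c legs M [] (initGrps obs)).map fun t =>
          t.coef * gint A f χ c legs (t.groups.flatMap Grp.pend) t.dirs).sum :=
  cexpansion_init (f := f) hA (fun D => dlist_contDiff_one D hχ) (dlist_vexp_bounded c legs hχ hs) M obs

/-! ## §2  Higher derivatives of the cutoff vanish off the shell -/

omit [Fintype S] [DecidableEq S] in
/-- A function vanishing on an open set has all iterated directional derivatives vanishing there. [folklore]
[cite: BalabanImbrieJaffe1988, §5.14 p.312] -/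
theorem dlist_eq_zero_of_eqOn : ∀ (D : List (S → ℝ)) {g : (S → ℝ) → ℝ} {U : Set (S → ℝ)}, IsOpen U →
    (∀ φ ∈ U, g φ = 0) → ∀ φ ∈ U, dlist D g φ = 0
  | [], _, _, _, hg => hg
  | u :: D, g, U, hU, hg => by
    rw [dlist_cons]
    refine dlist_eq_zero_of_eqOn D hU (fun φ hφ => ?_)
    have h : g =ᶠ[nhds φ] fun _ => (0 : ℝ) := Filter.eventually_of_mem (hU.mem_nhds hφ) hg
    rw [h.fderiv_eq]
    simp

omit [Fintype S] [DecidableEq S] in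
/-- **Off the shell every `χ′`-term vanishes**: if `∂χ = 0` outside a closed set `Sh` (the shell where the cutoff is
not locally constant), then `(Π_D∂)χ = 0` outside `Sh` for every non-empty list of directions.
[cite: BalabanImbrieJaffe1988, §5.14 p.312] -/
theorem dlist_eq_zero_off_shell {χ : (S → ℝ) → ℝ} {Sh : Set (S → ℝ)} (hSh : IsClosed Sh)
    (hχS : ∀ φ, φ ∉ Sh → fderiv ℝ χ φ = 0) : ∀ {D : List (S → ℝ)}, D ≠ [] → ∀ φ, φ ∉ Sh → dlist D χ φ = 0
  | [], h => absurd rfl h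
  | u :: D, _ => fun φ hφ => by
    rw [dlist_cons]
    exact dlist_eq_zero_of_eqOn D hSh.isOpen_compl (fun ψ hψ => by simp [hχS ψ hψ]) φ hφ

/-- **THE `χ′` SMALL FACTOR OF A COMPONENT TERM** (Cauchy–Schwarz in `L²(dμ_{C,ℱ})`, as in `BIJ88VertexChiShell312` for
one derivative): a term with at least one `χ′`-direction is bounded by the Gaussian moment of its pending legs times
`K_D·√μ(Sh)`, `μ(Sh)` the (unnormalized) Gaussian mass of the shell. [cite: BalabanImbrieJaffe1988, §5.14 p.312] -/
theorem abs_gint_le_shell {A : Matrix S S ℝ} (hA : A.PosDef) (f : S → ℝ) (c : ι → ℝ) (legs : ι → List (S → ℝ))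
    {χ : (S → ℝ) → ℝ} (hχ : ContDiff ℝ ∞ χ) {K : List (S → ℝ) → ℝ}
    (hK : ∀ D φ, |dlist D χ φ * vexp c legs φ| ≤ K D) {Sh : Set (S → ℝ)} (hSh : IsClosed Sh)
    (hχS : ∀ φ, φ ∉ Sh → fderiv ℝ χ φ = 0) (P : List (S → ℝ)) {D : List (S → ℝ)} (hD : D ≠ []) :
    |gint A f χ c legs P D|
      ≤ Real.sqrt (∫ φ : S → ℝ, lmono (P ++ P) φ * (weight A φ * source f φ))
        * (K D * Real.sqrt (∫ φ : S → ℝ, Sh.indicator (fun _ => (1 : ℝ)) φ * (weight A φ * source f φ))) := by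
  have hPi : Integrable fun φ : S → ℝ => lmono P φ ^ 2 * (weight A φ * source f φ) := by
    have h := integrable_lmono hA f (H := fun _ => (1 : ℝ)) continuous_const (K := 1) (fun _ => by simp) (P ++ P)
    refine h.congr (Filter.Eventually.of_forall fun φ => ?_)
    simp only [lmono_append, mul_one, sq]
  have hgm : AEStronglyMeasurable (fun φ : S → ℝ => dlist D χ φ * vexp c legs φ) volume :=
    ((dlist_contDiff D hχ).continuous.mul (continuous_vexp c legs)).aestronglyMeasurable
  have h := abs_integral_mul_le_shell hA f (continuous_lmono P) hPi hgm (hK D) hSh.measurableSet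
    (fun φ hφ => by simp [dlist_eq_zero_off_shell hSh hχS hD φ hφ])
  refine h.trans (le_of_eq ?_)
  congr 2
  exact integral_congr_ae (Filter.Eventually.of_forall fun φ => by simp only [lmono_append, sq])

/-! ## §3  Counting the small factors of a term -/

omit [Fintype S] [DecidableEq S] in
/-- `M` times the number of components with at least `M` vertices is at most the total vertex count. [folklore]
[cite: BalabanImbrieJaffe1988, §5.14 p.312] -/
theorem mul_countP_le_sum_nv (M : ℕ) : ∀ gs : List (Grp S),
    M * gs.countP (fun g => decide (M ≤ g.nv)) ≤ (gs.map Grp.nv).sum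
  | [] => by simp
  | g :: gs => by
    have ih := mul_countP_le_sum_nv M gs
    by_cases h : M ≤ g.nv
    · rw [List.countP_cons_of_pos (by simpa using h), List.map_cons, List.sum_cons, Nat.mul_succ]
      omega
    · rw [List.countP_cons_of_neg (by simpa using h), List.map_cons, List.sum_cons]
      omega

omit [Fintype S] [DecidableEq S] in
/-- The number of components with a `χ′` is at most the total `χ′`-count. [folklore]
[cite: BalabanImbrieJaffe1988, §5.14 p.312] -/
theorem countP_le_sum_nchi : ∀ gs : List (Grp S), gs.countP (fun g => decide (0 < g.nchi)) ≤ (gs.map Grp.nchi).sum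
  | [] => by simp
  | g :: gs => by
    have ih := countP_le_sum_nchi gs
    by_cases h : 0 < g.nchi
    · rw [List.countP_cons_of_pos (by simpa using h), List.map_cons, List.sum_cons]
      omega
    · rw [List.countP_cons_of_neg (by simpa using h), List.map_cons, List.sum_cons]
      omega

/-- **EVERY REMAINDER COMPONENT IS PAID FOR** (*"By performing sufficiently many integrations by parts, we have arranged
for enough small factors … in the remainder terms"*): in every term of the expansion of a product of observables, every
component is constant or remainder; the term carries at least `M = m̄+1` differentiated-down vertices (coupling
constants, `ccoef_bound_init`) PER component with `≥ M` vertices, and at least one `χ′`-direction under the integral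
(`abs_gint_le_shell`) per component with a `χ′`. [cite: BalabanImbrieJaffe1988, §5.14 p.312] -/
theorem small_factor_count (A : Matrix S S ℝ) (f : S → ℝ) (c : ι → ℝ) (legs : ι → List (S → ℝ)) (M : ℕ)
    (obs : List (List (S → ℝ))) : ∀ t ∈ cterms A f c legs M [] (initGrps obs),
      (∀ g ∈ t.groups, g.IsConst M ∨ g.IsRem M) ∧
        M * t.groups.countP (fun g => decide (M ≤ g.nv)) ≤ t.nv ∧
          t.groups.countP (fun g => decide (0 < g.nchi)) ≤ t.dirs.length := by
  intro t ht
  obtain ⟨h1, h2, h3⟩ := cterms_init_sound A f c legs M obs t ht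
  exact ⟨fun g hg => Grp.isConst_or_isRem_of_complete (h1 g hg), h3 ▸ mul_countP_le_sum_nv M t.groups,
    h2 ▸ countP_le_sum_nchi t.groups⟩

omit [Fintype S] [DecidableEq S] in
/-- The potential of the initial state: `Σ_{observables} (#legs + 1 + M·A)`. [cite: BalabanImbrieJaffe1988, §5.14 p.311] -/
theorem pot_init (M Aₘ : ℕ) (obs : List (List (S → ℝ))) :
    pot M Aₘ [] (initGrps obs) = (obs.map fun L => L.length + 1 + M * Aₘ).sum := by
  simp [pot, initGrps, gw, List.map_map, Function.comp_def]

/-- **THE VERTEX SMALL FACTORS OF THE TERMS OF A PRODUCT OF OBSERVABLES**: with all brackets between directions bounded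
by `B` and couplings by `c_M ≤ 1`, `|coef_t| ≤ (max B 1)^{pot₀} · c_M^{M·#(components of t with ≥ M vertices)}`.
[cite: BalabanImbrieJaffe1988, §5.14 p.312] -/
theorem ccoef_bound_init (A : Matrix S S ℝ) (f : S → ℝ) (c : ι → ℝ) (legs : ι → List (S → ℝ)) (M : ℕ)
    {Dir : Set (S → ℝ)} {B cM : ℝ} (hB : ∀ u ∈ Dir, ∀ v ∈ Dir, |(A⁻¹ *ᵥ u) ⬝ᵥ v| ≤ B)
    (hBf : ∀ u ∈ Dir, |(A⁻¹ *ᵥ u) ⬝ᵥ f| ≤ B) (hcM : 0 ≤ cM) (hcM1 : cM ≤ 1) (hcm : ∀ m, |c m| ≤ cM)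
    (hlegs : ∀ m, ∀ w ∈ legs m, w ∈ Dir) {obs : List (List (S → ℝ))} (hobs : ∀ L ∈ obs, ∀ w ∈ L, w ∈ Dir) :
    ∀ t ∈ cterms A f c legs M [] (initGrps obs),
      |t.coef| ≤ (max B 1) ^ (obs.map fun L => L.length + 1 + M * maxArity legs).sum * cM ^ t.nv ∧
        |t.coef| ≤ (max B 1) ^ (obs.map fun L => L.length + 1 + M * maxArity legs).sum
          * cM ^ (M * t.groups.countP (fun g => decide (M ≤ g.nv))) := by
  intro t ht
  have h := ccoef_bound A f c legs M hB hBf hcM hcm hlegs _ [] (initGrps obs) (Nat.lt_succ_self _)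
    (fun g hg w hw => by
      simp only [List.nil_append, initGrps, List.mem_map] at hg
      obtain ⟨L, hL, rfl⟩ := hg
      exact hobs L hL w hw) t ht
  rw [pot_init] at h
  refine ⟨h, h.trans (mul_le_mul_of_nonneg_left ?_ (pow_nonneg (zero_le_one.trans (le_max_right _ _)) _))⟩
  exact pow_le_pow_of_le_one hcM hcM1 (small_factor_count A f c legs M obs t ht).2.1

/-- **A REMAINDER TERM CARRIES A SMALL FACTOR — THE DICHOTOMY**: a term of the expansion of a product of observables
with a remainder component either has a `χ′` under its integral (`dirs ≠ []`, bounded through the shell by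
`abs_gint_le_shell`) or at least `M = m̄+1` coupling constants in its coefficient (`|coef| ≤ (max B 1)^{pot₀}·c_M^M`).
[cite: BalabanImbrieJaffe1988, §5.14 p.312] -/
theorem remainder_term_dichotomy (A : Matrix S S ℝ) (f : S → ℝ) (c : ι → ℝ) (legs : ι → List (S → ℝ)) (M : ℕ)
    {Dir : Set (S → ℝ)} {B cM : ℝ} (hB : ∀ u ∈ Dir, ∀ v ∈ Dir, |(A⁻¹ *ᵥ u) ⬝ᵥ v| ≤ B)
    (hBf : ∀ u ∈ Dir, |(A⁻¹ *ᵥ u) ⬝ᵥ f| ≤ B) (hcM : 0 ≤ cM) (hcM1 : cM ≤ 1) (hcm : ∀ m, |c m| ≤ cM)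
    (hlegs : ∀ m, ∀ w ∈ legs m, w ∈ Dir) {obs : List (List (S → ℝ))} (hobs : ∀ L ∈ obs, ∀ w ∈ L, w ∈ Dir) :
    ∀ t ∈ cterms A f c legs M [] (initGrps obs), (∃ g ∈ t.groups, g.IsRem M) →
      t.dirs ≠ [] ∨ |t.coef| ≤ (max B 1) ^ (obs.map fun L => L.length + 1 + M * maxArity legs).sum * cM ^ M := by
  intro t ht ⟨g, hg, hr⟩
  obtain ⟨-, hv, hd⟩ := small_factor_count A f c legs M obs t ht
  rcases hr with hr | hr
  · refine Or.inl (List.ne_nil_of_length_pos (lt_of_lt_of_le ?_ hd))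
    exact List.countP_pos_iff.2 ⟨g, hg, by simpa using hr⟩
  · refine Or.inr (((ccoef_bound_init A f c legs M hB hBf hcM hcM1 hcm hlegs hobs t ht).1).trans
      (mul_le_mul_of_nonneg_left (pow_le_pow_of_le_one hcM hcM1 ?_)
        (pow_nonneg (zero_le_one.trans (le_max_right _ _)) _)))
    have h1 : 0 < t.groups.countP (fun g => decide (M ≤ g.nv)) := List.countP_pos_iff.2 ⟨g, hg, by simpa using hr⟩
    calc M = M * 1 := (mul_one M).symm
      _ ≤ M * t.groups.countP (fun g => decide (M ≤ g.nv)) := Nat.mul_le_mul_left M h1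
      _ ≤ t.nv := hv

/-! ## §4  On the law of the fields of `W` (the model of record of §5.13–5.14) -/

variable {α I : Type} [Fintype α] [DecidableEq α] [Fintype I] [DecidableEq I]
  (blk : α → I) (Δ : Matrix α α ℝ) (ℱ : α → ℝ) (W : Finset I)

/-- **THE COMPONENT EXPANSION ON THE LAW OF THE FIELDS OF `W`**: `∫ Π_{all legs}Φ·χe^{−V} dfieldLaw =
Σ_t coef_t ∫ Π_{pending legs of t}Φ·(Π_{dirs t}∂)χ·e^{−V} dfieldLaw` for p36's `fieldLaw blk Δ ℱ W` (precision
`prec blk Δ W (corner ℝ W)` positive definite, source `src blk ℱ W`), `χ` smooth with compact support.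
[cite: BalabanImbrieJaffe1988, §5.14 p.311–312] -/
theorem cexpansion_fieldLaw (hPD : (prec blk Δ W (corner ℝ W)).PosDef) (c : ι → ℝ)
    (legs : ι → List ({x : α // blk x ∈ W} → ℝ)) {χ : ({x : α // blk x ∈ W} → ℝ) → ℝ} (hχ : ContDiff ℝ ∞ χ)
    (hs : HasCompactSupport χ) (M : ℕ) (obs : List (List ({x : α // blk x ∈ W} → ℝ))) :
    ∫ φ, lmono obs.flatten φ * (χ φ * vexp c legs φ) ∂(fieldLaw blk Δ ℱ W)
      = ((cterms (prec blk Δ W (corner ℝ W)) (src blk ℱ W) c legs M [] (initGrps obs)).map fun t =>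
          t.coef * ∫ φ, lmono (t.groups.flatMap Grp.pend) φ * (dlist t.dirs χ φ * vexp c legs φ)
            ∂(fieldLaw blk Δ ℱ W)).sum := by
  rw [integral_fieldLaw, cexpansion_init_cs hPD (src blk ℱ W) c legs hχ hs M obs, div_eq_mul_inv,
    ← List.sum_map_mul_right]
  congr 1
  refine List.map_congr_left fun t _ => ?_
  rw [integral_fieldLaw, gint, div_eq_mul_inv, mul_assoc]

/-- **THE p. 312 DISPLAY ON THE LAW, PER COMPONENT** — *"⟨Π_{σ_i}F^{m̄}_{k,loc}(X_{σ_i})⟩ = Σ Π_c F^L_{k+1,loc}(X_c)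
⟨Π_r F_{k,rem}(X_r)⟩"*: normalized by `⟨χe^{−V}⟩`, a term all of whose legs are contracted and which met no `χ′`
contributes exactly its coefficient (a product of contraction weights — a number, no expectation left), every other
term (it then has a component with a `χ′` or pending legs in a vertex-saturated component, `small_factor_count`) its
coefficient times a normalized remainder expectation. [cite: BalabanImbrieJaffe1988, §5.14 p.312] -/
theorem cexpansion_display_fieldLaw (hPD : (prec blk Δ W (corner ℝ W)).PosDef) (c : ι → ℝ)
    (legs : ι → List ({x : α // blk x ∈ W} → ℝ)) {χ : ({x : α // blk x ∈ W} → ℝ) → ℝ} (hχ : ContDiff ℝ ∞ χ)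
    (hs : HasCompactSupport χ) (hZ : ∫ φ, χ φ * vexp c legs φ ∂(fieldLaw blk Δ ℱ W) ≠ 0) (M : ℕ)
    (obs : List (List ({x : α // blk x ∈ W} → ℝ))) :
    (∫ φ, lmono obs.flatten φ * (χ φ * vexp c legs φ) ∂(fieldLaw blk Δ ℱ W))
        / ∫ φ, χ φ * vexp c legs φ ∂(fieldLaw blk Δ ℱ W)
      = ((cterms (prec blk Δ W (corner ℝ W)) (src blk ℱ W) c legs M [] (initGrps obs)).map fun t =>
          if t.groups.flatMap Grp.pend = [] ∧ t.dirs = [] then t.coef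
          else t.coef * ((∫ φ, lmono (t.groups.flatMap Grp.pend) φ * (dlist t.dirs χ φ * vexp c legs φ)
            ∂(fieldLaw blk Δ ℱ W)) / ∫ φ, χ φ * vexp c legs φ ∂(fieldLaw blk Δ ℱ W))).sum := by
  rw [cexpansion_fieldLaw blk Δ ℱ W hPD c legs hχ hs M obs, div_eq_mul_inv, ← List.sum_map_mul_right]
  congr 1
  refine List.map_congr_left fun t _ => ?_
  split_ifs with h
  · rw [h.1, h.2, mul_assoc]
    simp only [lmono_nil, dlist_nil, one_mul]
    rw [mul_inv_cancel₀ hZ, mul_one]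
  · rw [div_eq_mul_inv, mul_assoc]

end Literature.MathematicalPhysics.QuantumFieldTheory.BalabanImbrieJaffe1984to88.BIJ88VertexComponentsFieldLaw312
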